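import Mathlib
import HarnessLib
import Summits.HubbardSuperconductivity.HubbardSuperconductivity.Theorems.KLProgrammeKLRegimeEngineV8Defs

/-!
# ERRATUM / v2 `Q`-part of the gen-3 engine package `…KLRegimeEngineV8Defs` (my §1–§2, landed by k3c2-p1 as p458215):
# the `Q`-part, the regime threshold and the coupling threshold must read the FULL renormalisation package `R` (all `Gfr j`),
# not only `(cr, cz)`

Why.  (a) Δ-UV (T2-2, folded as `…SplitBundleV10`): the scale-`0` counted leg term must absorb `≈ 32·Gfr0 + 4·cr` per counted leg through
`Q.CR·Klam²` — so `Q.CR` must dominate `R.Gfr 0`; (b) at every scale the frame's pieces sit in the propagators: the sectorised propagator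
constants (integration by parts in the tangential direction, up to 4 derivatives of `e_K`) read `R.Gfr j`, `j ≤ 4`, so `Q.CE`, `Q.CR` and the
smallness thresholds `c₃`, `U₀` must read them too (k3c2-p1's ORIGINAL `klEngR = 1 + cr + cz + Σ_{j≤4} Gfr j` had this right; my even-powers
rewrite kept `Gfr` only in `S'`).  Hypothesis-free well-formedness is kept by using SQUARES: `klEngRsq R = 1 + cr² + cz² + Σ_{j≤4} (Gfr j)²`,
`klEngPsq P = Klam² + C_W² + Cd² + 1`.  `klEngGeo` (the `G`-part) is UNCHANGED.  Suggested as the package's v2 (new names, k3c2-p1's module /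
namespace at his discretion) BEFORE the gen-3 skeleton is registered.  Definitions + positivity proofs only.
-/

noncomputable section

namespace Summit.HubbardSuperconductivity.HubbardSuperconductivity.Theorems.EngineV8

set_option linter.dupNamespace false -- summit = problem name (single-conjunct summit), D-0017

open Real Finset
open Summit.HubbardSuperconductivity.HubbardSuperconductivity.Theorems.KLRegimeSplit

/-- The size of the induction constants read by the engine, in squares: `Klam² + C_W² + Cd² + 1` (`≥ 1` unconditionally). -/
def klEngPsq (P : SplitConsts) : ℝ := P.Klam ^ 2 + P.C_W ^ 2 + P.Cd ^ 2 + 1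

/-- The size of the renormalisation package read by the engine, in squares: `1 + cr² + cz² + Σ_{j ≤ 4} (Gfr j)²` (`≥ 1` unconditionally). -/
def klEngRsq (R : RenConsts) : ℝ := 1 + R.cr ^ 2 + R.cz ^ 2 + ∑ j ∈ range 5, R.Gfr j ^ 2

/-- `1 ≤ klEngPsq P`. -/
theorem one_le_klEngPsq (P : SplitConsts) : 1 ≤ klEngPsq P := by
  unfold klEngPsq; nlinarith [sq_nonneg P.Klam, sq_nonneg P.C_W, sq_nonneg P.Cd]

/-- `1 ≤ klEngRsq R`. -/
theorem one_le_klEngRsq (R : RenConsts) : 1 ≤ klEngRsq R := by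
  unfold klEngRsq
  have h := sum_nonneg (s := range 5) fun j _ => sq_nonneg (R.Gfr j)
  nlinarith [sq_nonneg R.cr, sq_nonneg R.cz]

/-- `0 < klEngPsq P`. -/
theorem klEngPsq_pos (P : SplitConsts) : 0 < klEngPsq P := lt_of_lt_of_le one_pos (one_le_klEngPsq P)

/-- `0 < klEngRsq R`. -/
theorem klEngRsq_pos (R : RenConsts) : 0 < klEngRsq R := lt_of_lt_of_le one_pos (one_le_klEngRsq R)

/-- **`klEngQ2 P R` — the engine's constants `Q`, v2** (every constant reads the FULL `R`): `2^{20}·klEngPsq² ·klEngRsq²` throughout;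
`CL β n = 2^{20} klEngPsq² klEngRsq² (β²+1) 4ⁿ`; thresholds `L0 β = 2^{10}(⌈|β|⌉₊+1)²`, `M0 β L = 2^{10}(⌈|β|⌉₊+1)²(L+1)²`. -/
def klEngQ2 (P : SplitConsts) (R : RenConsts) : EngConsts where
  CE := 2 ^ 20 * klEngPsq P ^ 2 * klEngRsq R ^ 2
  CR := 2 ^ 20 * klEngPsq P ^ 2 * klEngRsq R ^ 2
  c0 := 2 ^ 20 * klEngPsq P ^ 2 * klEngRsq R ^ 2
  cE4 := 2 ^ 20 * klEngPsq P ^ 2 * klEngRsq R ^ 2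
  S' := fun _ => 2 ^ 20 * klEngPsq P ^ 2 * klEngRsq R ^ 2
  Bf := 2 ^ 20 * klEngPsq P ^ 2 * klEngRsq R ^ 2
  SL := 2 ^ 20 * klEngPsq P ^ 2 * klEngRsq R ^ 2
  CL := fun β n => 2 ^ 20 * klEngPsq P ^ 2 * klEngRsq R ^ 2 * (β ^ 2 + 1) * (4 : ℝ) ^ n
  L0 := fun β => 2 ^ 10 * (⌈|β|⌉₊ + 1) ^ 2
  M0 := fun β L => 2 ^ 10 * (⌈|β|⌉₊ + 1) ^ 2 * (L + 1) ^ 2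

/-- **`klEngC₃2 P R` — the regime-constant threshold, v2**: `2^{-40}/(klEngPsq·klEngRsq²)`. -/
def klEngC₃2 (P : SplitConsts) (R : RenConsts) : ℝ := 1 / ((2 : ℝ) ^ 40 * klEngPsq P * klEngRsq R ^ 2)

/-- **`klEngU₀2 P R c` — the coupling threshold, v2**: `2^{-40}/(klEngPsq²·klEngRsq⁴·(c²+1))` (so that every frame allowance
`Gfr j·|U|` is `≤ 2^{-40}`). -/
def klEngU₀2 (P : SplitConsts) (R : RenConsts) (c : ℝ) : ℝ :=
  1 / ((2 : ℝ) ^ 40 * klEngPsq P ^ 2 * klEngRsq R ^ 4 * (c ^ 2 + 1))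

/-- `klEngQ2 P R` is well formed (unconditionally). -/
theorem klEngQ2_wf (P : SplitConsts) (R : RenConsts) : (klEngQ2 P R).WF := by
  have hc : (0 : ℝ) ≤ 2 ^ 20 * klEngPsq P ^ 2 * klEngRsq R ^ 2 := by positivity
  refine ⟨hc, hc, hc, hc, fun _ => hc, hc, hc, fun β n => ?_⟩
  show (0 : ℝ) ≤ 2 ^ 20 * klEngPsq P ^ 2 * klEngRsq R ^ 2 * (β ^ 2 + 1) * (4 : ℝ) ^ n
  positivity

/-- `0 < klEngC₃2 P R`. -/
theorem klEngC₃2_pos (P : SplitConsts) (R : RenConsts) : 0 < klEngC₃2 P R := by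
  unfold klEngC₃2
  have := klEngPsq_pos P
  have := klEngRsq_pos R
  positivity

/-- `0 < klEngU₀2 P R c`. -/
theorem klEngU₀2_pos (P : SplitConsts) (R : RenConsts) (c : ℝ) : 0 < klEngU₀2 P R c := by
  unfold klEngU₀2
  have := klEngPsq_pos P
  have := klEngRsq_pos R
  positivity

/-- What v2 buys for Δ-UV: the leg-dressing constant dominates every frame allowance — `Gfr j ≤ klEngRsq R` for `j ≤ 4`
(`x ≤ 1 + x²`), hence `32·Gfr 0 + 4·cr ≤ 36·klEngRsq R ≤ 2^{20}·klEngPsq²·klEngRsq² = (klEngQ2 P R).CR`. -/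
theorem gfr_le_klEngRsq (R : RenConsts) {j : ℕ} (hj : j < 5) : R.Gfr j ≤ klEngRsq R := by
  unfold klEngRsq
  have h1 : R.Gfr j ≤ 1 + R.Gfr j ^ 2 := by nlinarith [sq_nonneg (R.Gfr j - 1 / 2)]
  have h2 : R.Gfr j ^ 2 ≤ ∑ i ∈ range 5, R.Gfr i ^ 2 :=
    single_le_sum (f := fun i => R.Gfr i ^ 2) (fun i _ => sq_nonneg (R.Gfr i)) (mem_range.2 hj)
  nlinarith [sq_nonneg R.cr, sq_nonneg R.cz]

/-- `cr ≤ klEngRsq R`. -/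
theorem cr_le_klEngRsq (R : RenConsts) : R.cr ≤ klEngRsq R := by
  unfold klEngRsq
  have h := sum_nonneg (s := range 5) fun j _ => sq_nonneg (R.Gfr j)
  nlinarith [sq_nonneg (R.cr - 1 / 2), sq_nonneg R.cz]

/-- The Δ-UV absorption inequality at the package: `32·Gfr 0 + 4·cr ≤ (klEngQ2 P R).CR`. -/
theorem deltaUV_absorbed (P : SplitConsts) (R : RenConsts) : 32 * R.Gfr 0 + 4 * R.cr ≤ (klEngQ2 P R).CR := by
  show 32 * R.Gfr 0 + 4 * R.cr ≤ 2 ^ 20 * klEngPsq P ^ 2 * klEngRsq R ^ 2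
  have h0 := gfr_le_klEngRsq R (j := 0) (by norm_num)
  have h1 := cr_le_klEngRsq R
  have hr := one_le_klEngRsq R
  have hp := one_le_klEngPsq P
  have hp2 : 1 ≤ klEngPsq P ^ 2 := by nlinarith
  have hr2 : klEngRsq R ≤ klEngRsq R ^ 2 := by nlinarith
  nlinarith

end Summit.HubbardSuperconductivity.HubbardSuperconductivity.Theorems.EngineV8

end
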